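import Mathlib
import Summits.ResolutionOfSingularities.ResolutionOfSingularities.Theorems.WeightedInvariantLocalWeightedDropWildMonicFlagAttainBridge
import Summits.ResolutionOfSingularities.ResolutionOfSingularities.Theorems.WeightedInvariantLocalWeightedDropWildMonicFlagAttainPair
import Summits.ResolutionOfSingularities.ResolutionOfSingularities.Theorems.WeightedInvariantLocalWeightedDropWildMonicFlagSTop

/-!
# `WeightedInvariant.LocalWeightedDrop`, line `hasse-ridge-face-selection`, S3ρ sub-stub S3ρD `stub_wildMonicSurfaceDescent`: item D-0
# «maximising flag» — THE PAIR CLASS THROUGH THE DICTIONARY: `hpair` of `hattain₀_of_pairAttain` from stub-5's kernel instantiation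
# `exists_isGreatest_sFlag_pair_of`, stub-1's «`s = ⊤`» lemma and the two inputs of Per17 §5.3 (ord-cleaning 5.3.4, plane half 5.3.3 (3))

Crux item stmt-ResolutionOfSingularities-8899 `LocalWeightedDrop` (route `ResolutionOfSingularities/WeightedInvariant`), engine of the door
`HypersurfaceCentreConstruction` stmt-ResolutionOfSingularities-19897.  [OURS · L1 W4.3, chain w43, res-L1-w43-stub-3 (gen 4) on roadmap item
D-0 of `L/res-L1-w43-stub-7/S3RHOD-ROADMAP.md` (owners res-type-083 / stub-7); spec `L/res-L1-w43-stub-3/D0-SPEC.md` §8; split with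
res-D-pv-056 AS stub-5 (STATUS 2026-08-27T09:15:07Z).  MODEL: S. Perlega, thesis Wien 2017 / arXiv:2011.14443 §7.4.3 (Props. 7.4.5, 7.4.6,
7.4.10, Lemma 7.4.11), §7.4.1 Lemma 7.4.2 («`m_𝓕` only depends on `𝓕₂`»), §5.3 (Lemmas 5.3.3, 5.3.4, Prop. 5.3.5).  Nothing here is a
statement of H. Hironaka's manuscript; every object is OURS; AI-written, gate-accepted means sorry-free with standard axioms, not refereed.
Definition-free.]

THE SITUATION after `…FlagAttainBridge` (p520224): `hattain₀` of `attainShape_isFlagTriple_of` at `(A, E, D)` is reduced to `hpair` — the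
`s`-attainment over the PAIRS `(g, h)` of an orientation `o` whose boundary misses the curve letter (`1 ∉ orientE o E`), within the class
«valid (`IsMMax`) with residual order `dRes = D`».  Stub-5's `exists_isGreatest_sFlag_pair_of` (`…FlagAttainPair`, p517974) is Per17
Prop. 5.3.5 for pairs on a `wMin`-SETTING CLASS, modulo ord-cleaning (`hclean`, Lemma 5.3.4) and the plane half of Lemma 5.3.3 (3) (`h3h`).
This file supplies the DICTIONARY between the two classes and discharges every other hypothesis of the kernel:
* `mOf_subst_shift_pair`, `mOf_le_of_isMMax_pair`, **`isMMax_pair_iff`** — VALIDITY IS `h`-INDEPENDENT (Lemma 7.4.2 in game form): for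
  `1 ∉ E` the `m` of a pair is the `x₀`-multiplicity, preserved by the transport `(g, h) ↦ (θ_{h′}^* g, h + h′)` (`excExp_shear_eq`), so a
  pair is valid iff its `m` equals the `m` of any valid pair; hence «valid ∧ `dRes = D`» is ONE setting class `(D, r)` = one `wMin`-class for
  the weights `(1,1)` and (`0 ∈ E`) `(1,0)`, whose `hmax` follows from validity + topness as in `exists_isGreatest_sValue_recentre`;
* `hfin` of the kernel: in the regime `D ≥ d!` from stub-1's `exists_dRes_lt_of_sFlag_eq_top_flag` (`…FlagSTop`, p520259: `s = ⊤` at a valid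
  pair ⇒ a valid pair with larger `dRes`, impossible at the top) — in the companion regime `0 < D < d!` a member with `sFlag = ⊤` is simply
  the greatest one, and `sValue` is finite there because the corner term of `sComp_eq_min` is (`sValue_ne_top_of_not_mem`);
* the `s`-entry: `sValue d!` is monotone in `sFlag` on the class (`…FlagCompanionReading`).
RESULTS: **`exists_isGreatest_sValue_pair`** — `hpair` of one orientation from (`hclean`, `h3h`) in CLASS LANGUAGE; **`hattain₀_of_clean3h`**
— `hattain₀` at `(A, E, D)` from the per-orientation (`hclean`, `h3h`) alone.  WHAT REMAINS of D-0 (`AttainShape (IsFlagTriple d) p`) after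
this file, by name: HN (hbounds (iii), Per17 Prop. 7.4.8 (2)) and, per non-coordinate orientation of a top class, `hclean` + `h3h` (Per17
Lemma 5.3.4 and Lemma 5.3.3 (3) plane half — res-D-pv-056's `L533-PLANE-HALF-DESIGN.md`).
-/

set_option linter.dupNamespace false -- mandated namespace of this single-conjunct summit

namespace Summit.ResolutionOfSingularities.ResolutionOfSingularities.Theorems

namespace WildMonic

open MvPowerSeries MonicDescent
open Literature.AlgebraicGeometry.Resolution
open Literature.AlgebraicGeometry.Resolution.HauserPerlega2024 (Triple)
open PurePowerFlag (swap swapE orient orientE IsN0 IsTangent)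

variable {k : Type} [Field k] {d : ℕ}

/-! ## Validity of pairs is `h`-independent (Per17 Lemma 7.4.2 in game form) -/

section Valid

variable {E : Finset (Fin 2)}

/-- The transported re-centring vanishes at the origin. -/
theorem constantCoeff_subst_shift_eq_zero {g : MvPowerSeries (Fin 2) k} (hg : constantCoeff g = 0) {h : PowerSeries k}
    (hh : PowerSeries.constantCoeff h = 0) : constantCoeff (subst (PurePowerFlag.shift h) g) = 0 :=
  constantCoeff_subst_eq_zero (PurePowerFlag.hasSubst_shift' h hh) (PurePowerFlag.constantCoeff_shift h hh) hg

/-- TRANSPORT OF `m` ALONG THE PLANE SHEAR (`1 ∉ E`): the pair `(θ_{h′}^* g, h + h′)` has the same `m` as `(g, h)` — its flag tuple is the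
`θ_{h′}`-shear of the flag tuple of `(g, h)` (`subst_shift_flagTuple`) and the shear preserves the exceptional exponents (`excExp_shear_eq`).
[cite: Perlega2020, Lemma 7.4.2 (arXiv:2011.14443 chunk p0092)] -/
theorem mOf_subst_shift_pair (hE : (1 : Fin 2) ∉ E) (A : Fin d → MvPowerSeries (Fin 2) k) (g : MvPowerSeries (Fin 2) k)
    {h h' : PowerSeries k} (hh : PowerSeries.constantCoeff h = 0) (hh' : PowerSeries.constantCoeff h' = 0) :
    mOf d A E (subst (PurePowerFlag.shift h') g) (h + h') = mOf d A E g h := by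
  rw [mOf_of_isN0 (Or.inl hE), mOf_of_isN0 (Or.inl hE)]
  have hft : flagTuple d A (subst (PurePowerFlag.shift h') g) (h + h') =
      fun j => subst (PurePowerFlag.shift h') (flagTuple d A g h j) := by
    funext j
    rw [subst_shift_flagTuple A g hh hh' j, flagTuple_def]
  rw [hft, excExp_shear_eq hE hh']

/-- Every pair is dominated in `m` by a valid pair (transport to the valid pair's shear). -/
theorem mOf_le_of_isMMax_pair (hE : (1 : Fin 2) ∉ E) (A : Fin d → MvPowerSeries (Fin 2) k) {g₂ : MvPowerSeries (Fin 2) k}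
    {h₂ : PowerSeries k} (hh₂ : PowerSeries.constantCoeff h₂ = 0) (hmax₂ : IsMMax d A E g₂ h₂)
    {g : MvPowerSeries (Fin 2) k} {h : PowerSeries k} (hg : constantCoeff g = 0) (hh : PowerSeries.constantCoeff h = 0) :
    mOf d A E g h ≤ mOf d A E g₂ h₂ := by
  have hH : PowerSeries.constantCoeff (h₂ - h) = 0 := by rw [map_sub, hh₂, hh, sub_zero]
  have h1 := hmax₂ (subst (PurePowerFlag.shift (h₂ - h)) g) (constantCoeff_subst_shift_eq_zero hg hH)
  have h2 : mOf d A E (subst (PurePowerFlag.shift (h₂ - h)) g) (h + (h₂ - h)) = mOf d A E g h :=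
    mOf_subst_shift_pair hE A g hh hH
  rw [show h + (h₂ - h) = h₂ by ring] at h2
  rw [h2] at h1
  exact h1

/-- **VALIDITY IS `h`-INDEPENDENT**: given one valid pair `(g₂, h₂)`, a pair `(g, h)` is valid iff `m(g, h) = m(g₂, h₂)`. -/
theorem isMMax_pair_iff (hE : (1 : Fin 2) ∉ E) (A : Fin d → MvPowerSeries (Fin 2) k) {g₂ : MvPowerSeries (Fin 2) k}
    {h₂ : PowerSeries k} (hg₂ : constantCoeff g₂ = 0) (hh₂ : PowerSeries.constantCoeff h₂ = 0) (hmax₂ : IsMMax d A E g₂ h₂)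
    {g : MvPowerSeries (Fin 2) k} {h : PowerSeries k} (hg : constantCoeff g = 0) (hh : PowerSeries.constantCoeff h = 0) :
    IsMMax d A E g h ↔ mOf d A E g h = mOf d A E g₂ h₂ :=
  ⟨fun hm => le_antisymm (mOf_le_of_isMMax_pair hE A hh₂ hmax₂ hg hh) (mOf_le_of_isMMax_pair hE A hh hm hg₂ hh₂),
    fun hm _ hg' => hm ▸ mOf_le_of_isMMax_pair hE A hh₂ hmax₂ hg' hh⟩

/-- For `1 ∉ E` the second exceptional exponent vanishes. -/
theorem excExp_one_eq_zero_of_not_mem (hE : (1 : Fin 2) ∉ E) (N : Set (Fin 2 →₀ ℕ)) : excExp E N 1 = 0 := by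
  rw [excExp_apply_one, if_neg hE]

/-- For `1 ∉ E` and `0 < dRes E N < L` the `s`-entry is FINITE whatever `sFlag` is: the corner term of `sComp_eq_min` lies on the row
`0 < D(L−D)`. -/
theorem sValue_ne_top_of_not_mem (hE : (1 : Fin 2) ∉ E) {N : Set (Fin 2 →₀ ℕ)} {L : ℕ} (hpos : 0 < dRes E N) (hlt : dRes E N < L) :
    sValue L E N ≠ ⊤ := by
  rw [sValue_of_lt hlt hpos, sComp_eq_min L E N hlt]
  refine ne_top_of_le_ne_top ?_ (min_le_left _ _)
  have hrow : (dRes E N • excExp E N) 1 < dRes E N * (L - dRes E N) := by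
    rw [Finsupp.smul_apply, smul_eq_mul, excExp_one_eq_zero_of_not_mem hE, mul_zero]
    exact Nat.mul_pos hpos (Nat.sub_pos_of_lt hlt)
  exact ne_top_of_le_ne_top (ENat.coe_ne_top _) (coeffOrd_le (Set.mem_singleton _) hrow)

end Valid

/-! ## The pair class through the dictionary -/

section PairClass

variable (p : ℕ) [Fact p.Prime] [CharP k p]

/-- **`hpair` OF ONE ORIENTATION FROM (hclean, h3h)** — Per17 Prop. 5.3.5 for the pairs `(g, h)` of a position `A` with boundary `E`,
`1 ∉ E`, read in the class «valid (`IsMMax`) with residual order `dRes = D`», `D > 0` the top residual order of the valid pairs: the class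
has a member with FINITE `sValue d!` DOMINATING the class — provided (Lemma 5.3.4, `hclean`) every member with `B₀ < sFlag < ⊤` is dominated
in `sFlag` by an ORD-CLEAN member (`P`) and (Lemma 5.3.3 (3) plane half, `h3h`) from an ord-clean member with `sFlag = M > B₀` a member with
`sFlag ≥ M` differs by a shear of order `≥ M/D!`.  Everything else (the setting dictionary, `hmax` from validity + topness, the shear
invariance `hW`, completeness, `husc`/`hdrop`, `hfin` from stub-1's «`s = ⊤`» lemma in the regime `D ≥ d!` and from the companion corner
term otherwise) is discharged here on top of stub-5's `exists_isGreatest_sFlag_pair_of`.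
[cite: Perlega2020, Prop. 5.3.5 with Lemmas 5.3.3, 5.3.4; Props. 7.4.5 (3), 7.4.6; Lemmas 7.4.2, 7.4.11 (arXiv:2011.14443 §5.3 p0066–p0067,
§7.4 p0092–p0095)] -/
theorem exists_isGreatest_sValue_pair (hd : 0 < d) {A : Fin d → MvPowerSeries (Fin 2) k} {E : Finset (Fin 2)} (hA : IsPos d A)
    (hex : ¬ Exit₃ p d A) (hE : (1 : Fin 2) ∉ E) {D : ℕ} (hD : 0 < D)
    (htop : ∀ (g : MvPowerSeries (Fin 2) k) (h : PowerSeries k), constantCoeff g = 0 → PowerSeries.constantCoeff h = 0 →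
      IsMMax d A E g h → dRes E (newtonSet (flagTuple d A g h)) ≤ D)
    (P : MvPowerSeries (Fin 2) k × PowerSeries k → Prop) (B₀ : ℕ)
    (hclean : ∀ (g : MvPowerSeries (Fin 2) k) (h : PowerSeries k), constantCoeff g = 0 → PowerSeries.constantCoeff h = 0 →
      IsMMax d A E g h → dRes E (newtonSet (flagTuple d A g h)) = D →
      (B₀ : ℕ∞) < sFlag E (newtonSet (flagTuple d A g h)) → sFlag E (newtonSet (flagTuple d A g h)) ≠ ⊤ →
      ∃ (g' : MvPowerSeries (Fin 2) k) (h' : PowerSeries k), constantCoeff g' = 0 ∧ PowerSeries.constantCoeff h' = 0 ∧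
        IsMMax d A E g' h' ∧ dRes E (newtonSet (flagTuple d A g' h')) = D ∧ P (g', h') ∧
        sFlag E (newtonSet (flagTuple d A g h)) ≤ sFlag E (newtonSet (flagTuple d A g' h')))
    (h3h : ∀ (g : MvPowerSeries (Fin 2) k) (h : PowerSeries k) (g' : MvPowerSeries (Fin 2) k) (h' : PowerSeries k) (M : ℕ),
      constantCoeff g = 0 → PowerSeries.constantCoeff h = 0 → IsMMax d A E g h → dRes E (newtonSet (flagTuple d A g h)) = D →
      P (g, h) → constantCoeff g' = 0 → PowerSeries.constantCoeff h' = 0 → IsMMax d A E g' h' →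
      dRes E (newtonSet (flagTuple d A g' h')) = D → B₀ < M → sFlag E (newtonSet (flagTuple d A g h)) = M →
      (M : ℕ∞) ≤ sFlag E (newtonSet (flagTuple d A g' h')) → (M : ℕ∞) ≤ (D.factorial : ℕ∞) * (h' - h).order)
    (hne : ∃ (g : MvPowerSeries (Fin 2) k) (h : PowerSeries k), constantCoeff g = 0 ∧ PowerSeries.constantCoeff h = 0 ∧
      IsMMax d A E g h ∧ dRes E (newtonSet (flagTuple d A g h)) = D) :
    ∃ (g : MvPowerSeries (Fin 2) k) (h : PowerSeries k), constantCoeff g = 0 ∧ PowerSeries.constantCoeff h = 0 ∧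
      IsMMax d A E g h ∧ dRes E (newtonSet (flagTuple d A g h)) = D ∧
      sValue d.factorial E (newtonSet (flagTuple d A g h)) ≠ ⊤ ∧
      ∀ (g' : MvPowerSeries (Fin 2) k) (h' : PowerSeries k), constantCoeff g' = 0 → PowerSeries.constantCoeff h' = 0 →
        IsMMax d A E g' h' → dRes E (newtonSet (flagTuple d A g' h')) = D →
        sValue d.factorial E (newtonSet (flagTuple d A g' h')) ≤ sValue d.factorial E (newtonSet (flagTuple d A g h)) := by
  obtain ⟨g₂, h₂, hg₂, hh₂, hmax₂, hD₂⟩ := hne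
  -- non-annihilation (`¬ Exit₃`)
  have hnz : ∀ (g : MvPowerSeries (Fin 2) k) (h : PowerSeries k), constantCoeff g = 0 → PowerSeries.constantCoeff h = 0 →
      (newtonSet (flagTuple d A g h)).Nonempty := fun g h hg hh => newtonSet_flagTuple_nonempty hex hg hh
  -- validity ⟺ `excExp 0 = M`
  set M : ℕ := mOf d A E g₂ h₂ with hM
  have hmOf : ∀ (g : MvPowerSeries (Fin 2) k) (h : PowerSeries k),
      mOf d A E g h = excExp E (newtonSet (flagTuple d A g h)) 0 := fun g h => by
    rw [mOf_of_isN0 (Or.inl hE), excExp_one_eq_zero_of_not_mem hE, add_zero]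
  have hval : ∀ (g : MvPowerSeries (Fin 2) k) (h : PowerSeries k), constantCoeff g = 0 → PowerSeries.constantCoeff h = 0 →
      (IsMMax d A E g h ↔ excExp E (newtonSet (flagTuple d A g h)) 0 = M) := fun g h hg hh => by
    rw [← hmOf, isMMax_pair_iff hE A hg₂ hh₂ hmax₂ hg hh]
  have hmle : ∀ (g : MvPowerSeries (Fin 2) k) (h : PowerSeries k), constantCoeff g = 0 → PowerSeries.constantCoeff h = 0 →
      excExp E (newtonSet (flagTuple d A g h)) 0 ≤ M := fun g h hg hh => by
    rw [← hmOf]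
    exact mOf_le_of_isMMax_pair hE A hh₂ hmax₂ hg hh
  have hr₂0 : excExp E (newtonSet (flagTuple d A g₂ h₂)) 0 = M := (hval g₂ h₂ hg₂ hh₂).1 hmax₂
  -- the exceptional exponents of the class
  set r₂ : Fin 2 →₀ ℕ := excExp E (newtonSet (flagTuple d A g₂ h₂)) with hr₂
  have hexc : ∀ (g : MvPowerSeries (Fin 2) k) (h : PowerSeries k), constantCoeff g = 0 → PowerSeries.constantCoeff h = 0 →
      (IsMMax d A E g h ↔ excExp E (newtonSet (flagTuple d A g h)) = r₂) := fun g h hg hh => by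
    rw [hval g h hg hh]
    constructor
    · intro h0
      ext i
      fin_cases i
      · exact h0.trans hr₂0.symm
      · exact (excExp_one_eq_zero_of_not_mem hE _).trans (excExp_one_eq_zero_of_not_mem hE _).symm
    · intro h0
      rw [h0]
      exact hr₂0
  -- the weights the boundary sees, and their target values
  let W : Set (Fin 2 → ℕ) := {w | w = ![1, 1] ∨ ((0 : Fin 2) ∈ E ∧ w = ![1, 0])}
  let m : (Fin 2 → ℕ) → ℕ∞ := fun w => wMin w (flagTuple d A g₂ h₂)
  have h0₂ := wMin_eq_of_newtonSet_nonempty E (flagTuple d A g₂ h₂) (hnz g₂ h₂ hg₂ hh₂)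
  rw [hD₂] at h0₂
  -- DICTIONARY: «valid ∧ dRes = D» ⟺ «setting (D, r₂)» ⟺ «wMin-class of (g₂, h₂)»
  have hGW : ∀ (g : MvPowerSeries (Fin 2) k) (h : PowerSeries k), constantCoeff g = 0 → PowerSeries.constantCoeff h = 0 →
      ((dRes E (newtonSet (flagTuple d A g h)) = D ∧ excExp E (newtonSet (flagTuple d A g h)) = r₂) ↔
        ∀ w ∈ W, wMin w (flagTuple d A g h) = m w) := by
    intro g h hg hh
    have h1 := wMin_eq_of_newtonSet_nonempty E (flagTuple d A g h) (hnz g h hg hh)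
    constructor
    · rintro ⟨hδ, hr⟩
      rw [hδ, hr] at h1
      rintro w (rfl | ⟨h0E, rfl⟩)
      · show wMin ![1, 1] (flagTuple d A g h) = wMin ![1, 1] (flagTuple d A g₂ h₂)
        rw [h1.1, h0₂.1]
      · show wMin ![1, 0] (flagTuple d A g h) = wMin ![1, 0] (flagTuple d A g₂ h₂)
        rw [h1.2.1 h0E, h0₂.2.1 h0E]
    · intro hw
      have h11 : wMin ![1, 1] (flagTuple d A g h) = wMin ![1, 1] (flagTuple d A g₂ h₂) := hw _ (Or.inl rfl)
      have h10 : (0 : Fin 2) ∈ E → wMin ![1, 0] (flagTuple d A g h) = wMin ![1, 0] (flagTuple d A g₂ h₂) :=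
        fun h0E => hw _ (Or.inr ⟨h0E, rfl⟩)
      have h01 : (1 : Fin 2) ∈ E → wMin ![0, 1] (flagTuple d A g h) = wMin ![0, 1] (flagTuple d A g₂ h₂) :=
        fun h1E => absurd h1E hE
      exact ⟨(dRes_eq_of_wMin_eq E h10 h01 h11).trans hD₂, excExp_eq_of_wMin_eq E h10 h01⟩
  have hcls : ∀ (g : MvPowerSeries (Fin 2) k) (h : PowerSeries k), constantCoeff g = 0 → PowerSeries.constantCoeff h = 0 →
      ((IsMMax d A E g h ∧ dRes E (newtonSet (flagTuple d A g h)) = D) ↔ ∀ w ∈ W, wMin w (flagTuple d A g h) = m w) := by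
    intro g h hg hh
    rw [hexc g h hg hh, ← hGW g h hg hh, and_comm]
  -- the hypotheses of the kernel instantiation
  have hW : ∀ w ∈ W, ∀ φ : PowerSeries k, PowerSeries.constantCoeff φ = 0 →
      (∀ B : Fin d → MvPowerSeries (Fin 2) k, wMin w (fun i => subst (PurePowerFlag.shift φ) (B i)) = wMin w B) ∧
      ∀ g : MvPowerSeries (Fin 2) k, (subst (PurePowerFlag.shift φ) g).weightedOrder w = g.weightedOrder w := by
    rintro w (rfl | ⟨-, rfl⟩) φ hφ
    · exact ⟨fun B => wMin_one_one_shear hφ B, fun g => weightedOrder_subst_shift 1 1 hφ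
        (by rw [Nat.cast_one, one_mul]; exact one_le_order_of_constantCoeff hφ) g⟩
    · exact ⟨fun B => wMin_one_zero_shear hφ B, fun g => weightedOrder_subst_shift 1 0 hφ (by rw [Nat.cast_zero]; exact bot_le) g⟩
  have hpos : ∃ w ∈ W, 0 < m w := by
    refine ⟨![1, 1], Or.inl rfl, ?_⟩
    show 0 < wMin ![1, 1] (flagTuple d A g₂ h₂)
    rw [h0₂.1]
    exact_mod_cast (by omega : 0 < D + excExp E (newtonSet (flagTuple d A g₂ h₂)) 0 + excExp E (newtonSet (flagTuple d A g₂ h₂)) 1)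
  have hmaxW : ∀ (g : MvPowerSeries (Fin 2) k) (h : PowerSeries k), constantCoeff g = 0 → PowerSeries.constantCoeff h = 0 →
      (∀ w ∈ W, m w ≤ wMin w (flagTuple d A g h)) → ∀ w ∈ W, wMin w (flagTuple d A g h) ≤ m w := by
    intro g h hg hh hge
    have h1 := wMin_eq_of_newtonSet_nonempty E (flagTuple d A g h) (hnz g h hg hh)
    -- the `x₀`-exponent is `M` (bounded by `M`, and `≥ M` when `0 ∈ E`; `= 0 = M` when `0 ∉ E`)
    have he0 : excExp E (newtonSet (flagTuple d A g h)) 0 = M := by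
      by_cases h0E : (0 : Fin 2) ∈ E
      · have h2 := hge _ (Or.inr ⟨h0E, rfl⟩)
        change wMin ![1, 0] (flagTuple d A g₂ h₂) ≤ wMin ![1, 0] (flagTuple d A g h) at h2
        rw [h0₂.2.1 h0E, h1.2.1 h0E, Nat.cast_le] at h2
        exact le_antisymm (hmle g h hg hh) (hr₂0 ▸ h2)
      · rw [excExp_apply_zero, if_neg h0E]
        rw [← hr₂0, excExp_apply_zero, if_neg h0E]
    have hvalid : IsMMax d A E g h := (hval g h hg hh).2 he0
    have hDle := htop g h hg hh hvalid
    have hsum := hge _ (Or.inl rfl)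
    change wMin ![1, 1] (flagTuple d A g₂ h₂) ≤ wMin ![1, 1] (flagTuple d A g h) at hsum
    rw [h0₂.1, h1.1, Nat.cast_le] at hsum
    have he1 : excExp E (newtonSet (flagTuple d A g h)) 1 = 0 := excExp_one_eq_zero_of_not_mem hE _
    have he1₂ : excExp E (newtonSet (flagTuple d A g₂ h₂)) 1 = 0 := excExp_one_eq_zero_of_not_mem hE _
    have hf : excExp E (newtonSet (flagTuple d A g₂ h₂)) 0 = M := hr₂0
    have hDeq : dRes E (newtonSet (flagTuple d A g h)) = D := by omega
    have heq := (hcls g h hg hh).1 ⟨hvalid, hDeq⟩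
    exact fun w hw => (heq w hw).le
  have hδW : ∀ (g : MvPowerSeries (Fin 2) k) (h : PowerSeries k), constantCoeff g = 0 → PowerSeries.constantCoeff h = 0 →
      (∀ w ∈ W, wMin w (flagTuple d A g h) = m w) → dRes E (newtonSet (flagTuple d A g h)) = D :=
    fun g h hg hh hw => ((hGW g h hg hh).2 hw).1
  have hrW : ∀ (g : MvPowerSeries (Fin 2) k) (h : PowerSeries k), constantCoeff g = 0 → PowerSeries.constantCoeff h = 0 →
      (∀ w ∈ W, wMin w (flagTuple d A g h) = m w) → excExp E (newtonSet (flagTuple d A g h)) = r₂ :=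
    fun g h hg hh hw => ((hGW g h hg hh).2 hw).2
  have hcleanW : ∀ a : MvPowerSeries (Fin 2) k × PowerSeries k, constantCoeff a.1 = 0 → PowerSeries.constantCoeff a.2 = 0 →
      (∀ w ∈ W, wMin w (flagTuple d A a.1 a.2) = m w) → (B₀ : ℕ∞) < sFlag E (newtonSet (flagTuple d A a.1 a.2)) →
      sFlag E (newtonSet (flagTuple d A a.1 a.2)) ≠ ⊤ →
      ∃ b : MvPowerSeries (Fin 2) k × PowerSeries k, constantCoeff b.1 = 0 ∧ PowerSeries.constantCoeff b.2 = 0 ∧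
        (∀ w ∈ W, wMin w (flagTuple d A b.1 b.2) = m w) ∧ P b ∧
        sFlag E (newtonSet (flagTuple d A a.1 a.2)) ≤ sFlag E (newtonSet (flagTuple d A b.1 b.2)) := by
    intro a ha1 ha2 haw hB hT
    obtain ⟨hva, hDa⟩ := (hcls a.1 a.2 ha1 ha2).2 haw
    obtain ⟨g', h', hg', hh', hv', hD', hP', hle⟩ := hclean a.1 a.2 ha1 ha2 hva hDa hB hT
    exact ⟨(g', h'), hg', hh', (hcls g' h' hg' hh').1 ⟨hv', hD'⟩, hP', hle⟩
  have h3hW : ∀ (a b : MvPowerSeries (Fin 2) k × PowerSeries k) (M' : ℕ), constantCoeff a.1 = 0 →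
      PowerSeries.constantCoeff a.2 = 0 → (∀ w ∈ W, wMin w (flagTuple d A a.1 a.2) = m w) → P a → constantCoeff b.1 = 0 →
      PowerSeries.constantCoeff b.2 = 0 → (∀ w ∈ W, wMin w (flagTuple d A b.1 b.2) = m w) → B₀ < M' →
      sFlag E (newtonSet (flagTuple d A a.1 a.2)) = M' → (M' : ℕ∞) ≤ sFlag E (newtonSet (flagTuple d A b.1 b.2)) →
      (M' : ℕ∞) ≤ (D.factorial : ℕ∞) * (b.2 - a.2).order := by
    intro a b M' ha1 ha2 haw hPa hb1 hb2 hbw hB hsa hsb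
    obtain ⟨hva, hDa⟩ := (hcls a.1 a.2 ha1 ha2).2 haw
    obtain ⟨hvb, hDb⟩ := (hcls b.1 b.2 hb1 hb2).2 hbw
    exact h3h a.1 a.2 b.1 b.2 M' ha1 ha2 hva hDa hPa hb1 hb2 hvb hDb hB hsa hsb
  -- the `s`-entry on the class: monotone in `sFlag`, and finite in the companion regime
  have hsVal : ∀ (g : MvPowerSeries (Fin 2) k) (h : PowerSeries k) (g' : MvPowerSeries (Fin 2) k) (h' : PowerSeries k),
      constantCoeff g = 0 → PowerSeries.constantCoeff h = 0 → IsMMax d A E g h → dRes E (newtonSet (flagTuple d A g h)) = D →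
      constantCoeff g' = 0 → PowerSeries.constantCoeff h' = 0 → IsMMax d A E g' h' → dRes E (newtonSet (flagTuple d A g' h')) = D →
      sFlag E (newtonSet (flagTuple d A g' h')) ≤ sFlag E (newtonSet (flagTuple d A g h)) →
      sValue d.factorial E (newtonSet (flagTuple d A g' h')) ≤ sValue d.factorial E (newtonSet (flagTuple d A g h)) := by
    intro g h g' h' hg hh hv hDg hg' hh' hv' hDg' hle
    refine sValue_le_sValue_of_sFlag_le _ E (by rw [hDg', hDg]) ?_ (by rw [hDg']; exact hD) hle
    rw [(hexc g' h' hg' hh').1 hv', (hexc g h hg hh).1 hv]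
  -- CASE 1: some member has `sFlag = ⊤` — it is the greatest (companion regime necessarily)
  by_cases hT : ∃ (g : MvPowerSeries (Fin 2) k) (h : PowerSeries k), constantCoeff g = 0 ∧ PowerSeries.constantCoeff h = 0 ∧
      IsMMax d A E g h ∧ dRes E (newtonSet (flagTuple d A g h)) = D ∧ sFlag E (newtonSet (flagTuple d A g h)) = ⊤
  · obtain ⟨g, h, hg, hh, hv, hDg, hs⟩ := hT
    -- `D < d!`: otherwise stub-1's «`s = ⊤`» lemma produces a valid pair beyond the top
    have hlt : D < d.factorial := by
      by_contra hle
      obtain ⟨g', hg', hv', hlt'⟩ := exists_dRes_lt_of_sFlag_eq_top_flag p hd hA hex E false hE hg hh hv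
        (show d.factorial ≤ dRes E (newtonSet (flagTuple d A g h)) by rw [hDg]; exact not_lt.mp hle) hs
      have h' : dRes E (newtonSet (flagTuple d A g' h)) ≤ D := htop g' h hg' hh hv'
      have hlt'' : dRes E (newtonSet (flagTuple d A g h)) < dRes E (newtonSet (flagTuple d A g' h)) := hlt'
      rw [hDg] at hlt''
      exact absurd (lt_of_lt_of_le hlt'' h') (lt_irrefl D)
    refine ⟨g, h, hg, hh, hv, hDg, sValue_ne_top_of_not_mem hE (by rw [hDg]; exact hD) (by rw [hDg]; exact hlt),
      fun g' h' hg' hh' hv' hDg' => hsVal g h g' h' hg hh hv hDg hg' hh' hv' hDg' ?_⟩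
    rw [hs]
    exact le_top
  · -- CASE 2: `sFlag` is finite on the class — the kernel
    have hfinW : ∀ (g : MvPowerSeries (Fin 2) k) (h : PowerSeries k), constantCoeff g = 0 → PowerSeries.constantCoeff h = 0 →
        (∀ w ∈ W, wMin w (flagTuple d A g h) = m w) → sFlag E (newtonSet (flagTuple d A g h)) ≠ ⊤ := by
      intro g h hg hh hw hs
      obtain ⟨hv, hDg⟩ := (hcls g h hg hh).2 hw
      exact hT ⟨g, h, hg, hh, hv, hDg, hs⟩
    obtain ⟨g, h, hg, hh, hw, hsfin, hge⟩ := exists_isGreatest_sFlag_pair_of hd hE A W m D r₂ hW hpos hmaxW hδW hrW P B₀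
      hcleanW h3hW ⟨g₂, h₂, hg₂, hh₂, ((hcls g₂ h₂ hg₂ hh₂).1 ⟨hmax₂, hD₂⟩)⟩ hfinW
    obtain ⟨hv, hDg⟩ := (hcls g h hg hh).2 hw
    refine ⟨g, h, hg, hh, hv, hDg, sValue_ne_top_of_sFlag_ne_top _ E (by rw [hDg]; exact hD) hsfin,
      fun g' h' hg' hh' hv' hDg' => hsVal g h g' h' hg hh hv hDg hg' hh' hv' hDg' ?_⟩
    exact hge g' h' hg' hh' ((hcls g' h' hg' hh').1 ⟨hv', hDg'⟩)

/-- A position stays a position under the letter swap, for either orientation. -/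
theorem isPos_orientT (o : Bool) {A : Fin d → MvPowerSeries (Fin 2) k} (hA : IsPos d A) : IsPos d (orientT o A) := by
  cases o
  · exact hA
  · exact isPos_swap hA

/-- **`hattain₀` AT `(A, E, D)` FROM THE PER-ORIENTATION (hclean, h3h) ALONE** — the composition of `hattain₀_of_pairAttain`
(`…FlagAttainBridge`: coordinate orientations discharged) with `exists_isGreatest_sValue_pair` (non-coordinate orientations from Per17
Lemma 5.3.4 + Lemma 5.3.3 (3) plane half).  For each orientation `o` with `1 ∉ orientE o E` the caller supplies an ord-cleanness predicate
`P o`, a threshold `B₀ o`, and the two Perlega inputs in class language; the conclusion is the `hattain₀` hypothesis of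
`attainShape_isFlagTriple_of` (p514376) at `(A, E, D)`. [cite: Perlega2020, Prop. 7.4.10, Lemma 7.4.11, Props. 7.4.5–7.4.6, §5.3
(arXiv:2011.14443 §7.4.3, §5.3)] -/
theorem hattain₀_of_clean3h (hd : 0 < d) {A : Fin d → MvPowerSeries (Fin 2) k} {E : Finset (Fin 2)} (hA : IsPos d A)
    (hex : ¬ Exit₃ p d A) {D : ℕ} (hD : 0 < D)
    (hexD : ∃ v, IsFlagTriple d A E v ∧ (ofLex v).1 = D ∧ (ofLex (ofLex v).2).1 = 0)
    (htop : ∀ w, IsFlagTriple d A E w → (ofLex w).1 ≤ D)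
    (P : Bool → MvPowerSeries (Fin 2) k × PowerSeries k → Prop) (B₀ : Bool → ℕ)
    (hclean : ∀ o : Bool, (1 : Fin 2) ∉ orientE o E → ∀ (g : MvPowerSeries (Fin 2) k) (h : PowerSeries k),
      constantCoeff g = 0 → PowerSeries.constantCoeff h = 0 → IsMMax d (orientT o A) (orientE o E) g h →
      dRes (orientE o E) (newtonSet (flagTuple d (orientT o A) g h)) = D →
      (B₀ o : ℕ∞) < sFlag (orientE o E) (newtonSet (flagTuple d (orientT o A) g h)) →
      sFlag (orientE o E) (newtonSet (flagTuple d (orientT o A) g h)) ≠ ⊤ →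
      ∃ (g' : MvPowerSeries (Fin 2) k) (h' : PowerSeries k), constantCoeff g' = 0 ∧ PowerSeries.constantCoeff h' = 0 ∧
        IsMMax d (orientT o A) (orientE o E) g' h' ∧ dRes (orientE o E) (newtonSet (flagTuple d (orientT o A) g' h')) = D ∧
        P o (g', h') ∧ sFlag (orientE o E) (newtonSet (flagTuple d (orientT o A) g h)) ≤
          sFlag (orientE o E) (newtonSet (flagTuple d (orientT o A) g' h')))
    (h3h : ∀ o : Bool, (1 : Fin 2) ∉ orientE o E → ∀ (g : MvPowerSeries (Fin 2) k) (h : PowerSeries k)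
      (g' : MvPowerSeries (Fin 2) k) (h' : PowerSeries k) (M : ℕ),
      constantCoeff g = 0 → PowerSeries.constantCoeff h = 0 → IsMMax d (orientT o A) (orientE o E) g h →
      dRes (orientE o E) (newtonSet (flagTuple d (orientT o A) g h)) = D → P o (g, h) →
      constantCoeff g' = 0 → PowerSeries.constantCoeff h' = 0 → IsMMax d (orientT o A) (orientE o E) g' h' →
      dRes (orientE o E) (newtonSet (flagTuple d (orientT o A) g' h')) = D → B₀ o < M →
      sFlag (orientE o E) (newtonSet (flagTuple d (orientT o A) g h)) = M →
      (M : ℕ∞) ≤ sFlag (orientE o E) (newtonSet (flagTuple d (orientT o A) g' h')) →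
      (M : ℕ∞) ≤ (D.factorial : ℕ∞) * (h' - h).order) :
    ∃ v, IsFlagTriple d A E v ∧ (ofLex v).1 = D ∧ (ofLex (ofLex v).2).1 = 0 ∧ (ofLex (ofLex v).2).2 ≠ ⊤ ∧
      ∀ w, IsFlagTriple d A E w → (ofLex w).1 = D → (ofLex (ofLex w).2).1 = 0 →
        (ofLex (ofLex w).2).2 ≤ (ofLex (ofLex v).2).2 := by
  refine hattain₀_of_pairAttain hd hex hD hexD htop fun o ho hne => ?_
  have htop' : ∀ (g : MvPowerSeries (Fin 2) k) (h : PowerSeries k), constantCoeff g = 0 → PowerSeries.constantCoeff h = 0 →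
      IsMMax d (orientT o A) (orientE o E) g h → dRes (orientE o E) (newtonSet (flagTuple d (orientT o A) g h)) ≤ D := by
    intro g h hg hh hv
    have h1 := htop _ ⟨o, g, h, hg, hh, Or.inl (Or.inl ho), hv, rfl⟩
    rw [flagTriple_of_isN0 (Or.inl ho)] at h1
    exact h1
  exact exists_isGreatest_sValue_pair p hd (isPos_orientT o hA) (not_exit₃_orientT o hex) ho hD htop' (P o) (B₀ o)
    (hclean o ho) (h3h o ho) hne

end PairClass

end WildMonic

end Summit.ResolutionOfSingularities.ResolutionOfSingularities.Theorems
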